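import Literature.Analysis.FunctionSpaces.BesselMoments
import Literature.Analysis.FunctionSpaces.BesselJAnalyticProofs
import Mathlib.Analysis.SpecialFunctions.Integrals.Basic
import Mathlib.MeasureTheory.Integral.DominatedConvergence
import Mathlib.Analysis.Normed.Ring.InfiniteSum
import HarnessLib

/-!
# The modified Bessel functions `I_n`: power series, full-period integral and the generating function `e^{x cos θ} = Σ_{m ∈ ℤ} I_{|m|}(x) e^{imθ}`

Topic `Literature/Analysis/FunctionSpaces`, a proofs sibling of `BesselMoments.lean`, whose
`besselI n x = π⁻¹ ∫₀^π e^{x cos θ} cos(nθ) dθ` (DLMF 10.32.3) is the tree's modified Bessel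
function of the first kind of integer order.  Everything is proved; no definition and no named
fact is introduced.  The argument is the generating-function argument of
`BesselJAnalyticProofs.lean` (Bessel's integral for `J_n`) with the sign of the second exponential
flipped:
* `hasSum_generatingFunctionI` — `e^{x cos θ} = exp((x/2)e^{iθ}) exp((x/2)e^{−iθ})
  = Σ_{j,l} ((x/2)e^{iθ})^j ((x/2)e^{−iθ})^l/(j! l!)` (absolutely convergent double series);
* `hasSum_integral_cexp_cos_mul_cexp_neg` — integrating against `e^{−inθ}` over `[0, 2π]` term by
  term (dominated convergence) keeps the diagonal `j = l + n`:
  `∫₀^{2π} e^{x cos θ} e^{−inθ} dθ = 2π Σ_k (x/2)^{2k+n}/(k!(k+n)!)`;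
* **`hasSum_besselI`** — the POWER SERIES `I_n(x) = Σ_k (x/2)^{2k+n}/(k!(k+n)!)` (DLMF 10.25.2) for
  the tree's integral-defined `besselI` (real part, symmetry `θ ↦ 2π − θ`); with it
  **`integral_exp_mul_cos_mul_cos`** `∫₀^{2π} e^{x cos θ} cos(nθ) dθ = 2π I_n(x)`, the complex
  coefficient form `integral_cexp_cos_mul_cexp_neg_nat`, `besselI_nonneg`, the parity
  `I_n(−x) = (−1)ⁿ I_n(x)` (DLMF 10.34.1) and `|I_n(x)| = I_n(|x|)`;
* **`hasSum_besselI_natAbs_mul_cexp`** — the GENERATING FUNCTION / Fourier series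
  `e^{x cos θ} = Σ_{m ∈ ℤ} I_{|m|}(x) e^{imθ}` (DLMF 10.35.1–2, `I_{−m} = I_m`), by summing the double
  series over the fibres `j − l = m` (`(m, k) ↦ (k + m⁺, k + m⁻)`); its absolute convergence; and at
  `θ = 0`, `Σ_{m ∈ ℤ} I_{|m|}(x) = eˣ` (DLMF 10.35.5).
These are the one-plaquette ingredients of the character (Fourier) expansion of two-dimensional
`U(1)` lattice gauge theory (venture `LatticeQCDFlow`).  NOT here: non-integer order, the
recurrences `I_{n−1} − I_{n+1} = (2n/x) I_n`, asymptotics, anything about `K_ν`.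

## References

* NIST DLMF §10.25.2 (series), §10.32.3 (integral), §10.35 (generating function and the Fourier
  series `e^{z cos θ} = I₀(z) + 2 Σ_{k ≥ 1} I_k(z) cos(kθ)`). [`DLMF`]
* G. N. Watson, *A Treatise on the Theory of Bessel Functions* (2nd ed., CUP 1944), §2.1–2.2 (the
  generating-function method), §3.7 (the functions `I_ν`). [`Watson1944`]
-/

noncomputable section

open scoped Nat
open Filter Real MeasureTheory Set intervalIntegral

namespace Literature.Analysis.FunctionSpaces

/-! ### 1. The generating function as a double series -/

/-- `exp((x/2)e^{iθ}) · exp((x/2)e^{−iθ}) = e^{x cos θ}`. [cite: DLMF, 10.35.1] -/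
theorem cexp_mul_cexp_eq_cexp_mul_cos (x θ : ℝ) :
    Complex.exp ((x / 2 : ℂ) * Complex.exp (θ * Complex.I)) *
        Complex.exp ((x / 2 : ℂ) * Complex.exp (-(θ * Complex.I))) =
      Complex.exp ((x : ℂ) * Real.cos θ) := by
  rw [← Complex.exp_add]
  congr 1
  have e1 : Complex.exp ((θ : ℂ) * Complex.I) = Complex.cos θ + Complex.sin θ * Complex.I :=
    Complex.exp_mul_I _
  have e2 : Complex.exp (-((θ : ℂ) * Complex.I)) = Complex.cos θ - Complex.sin θ * Complex.I := by
    rw [show -((θ : ℂ) * Complex.I) = (-(θ : ℂ)) * Complex.I by ring, Complex.exp_mul_I,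
      Complex.cos_neg, Complex.sin_neg]
    ring
  rw [Complex.ofReal_cos, e1, e2]
  ring

/-- `e^{x cos θ}` as a complex exponential is the real exponential. [folklore] -/
private theorem cexp_mul_cos_eq_ofReal (x θ : ℝ) :
    Complex.exp ((x : ℂ) * Real.cos θ) = ((Real.exp (x * Real.cos θ) : ℝ) : ℂ) := by
  rw [Complex.ofReal_exp]
  push_cast
  rfl

/-- **The generating-function double series**: for real `x, θ`,
`Σ_{j,k} ((x/2)e^{iθ})^j/j! · ((x/2)e^{−iθ})^k/k! = e^{x cos θ}` (absolutely convergent).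
[cite: DLMF, 10.35.1] -/
theorem hasSum_generatingFunctionI (x θ : ℝ) :
    HasSum (fun p : ℕ × ℕ =>
      ((x / 2 : ℂ) * Complex.exp (θ * Complex.I)) ^ p.1 / (p.1 ! : ℂ) *
        (((x / 2 : ℂ) * Complex.exp (-(θ * Complex.I))) ^ p.2 / (p.2 ! : ℂ)))
      (Complex.exp ((x : ℂ) * Real.cos θ)) := by
  have h := hasSum_prod_pow_div_factorial ((x / 2 : ℂ) * Complex.exp (θ * Complex.I))
    ((x / 2 : ℂ) * Complex.exp (-(θ * Complex.I)))
  rw [cexp_mul_cexp_eq_cexp_mul_cos] at h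
  exact h

/-! ### 2. The full-period Fourier coefficients of `e^{x cos θ}` -/

/-- **`∫₀^{2π} e^{x cos θ} e^{−inθ} dθ = 2π Σ_k (x/2)^{2k+n}/(k!(k+n)!)`** (`n ∈ ℕ`), in `HasSum`
form: integrating the generating-function double series term by term against `e^{−inθ}` keeps
exactly the diagonal `j = k + n`. [cite: Watson1944, §2.2] -/
theorem hasSum_integral_cexp_cos_mul_cexp_neg (n : ℕ) (x : ℝ) :
    HasSum (fun k : ℕ => (2 * π : ℂ) *
        ((((x / 2) ^ (2 * k + n) / ((k ! : ℝ) * ((k + n) ! : ℝ)) : ℝ) : ℂ)))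
      (∫ θ in (0 : ℝ)..2 * π,
        Complex.exp ((x : ℂ) * Real.cos θ) * Complex.exp (-((n : ℂ) * θ * Complex.I))) := by
  -- the summands, integrated term by term
  set F : ℕ × ℕ → ℝ → ℂ := fun p θ =>
    ((x / 2 : ℂ) * Complex.exp (θ * Complex.I)) ^ p.1 / (p.1 ! : ℂ) *
      (((x / 2 : ℂ) * Complex.exp (-(θ * Complex.I))) ^ p.2 / (p.2 ! : ℂ)) *
        Complex.exp (-((n : ℂ) * θ * Complex.I)) with hF
  have hFcont : ∀ p, Continuous (F p) := fun p => by
    simp only [hF]; fun_prop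
  have hFnorm : ∀ p θ, ‖F p θ‖ = (|x| / 2) ^ p.1 / (p.1 ! : ℝ) * ((|x| / 2) ^ p.2 / (p.2 ! : ℝ)) := by
    intro p θ
    have h2 : ‖Complex.exp (-((θ : ℂ) * Complex.I))‖ = 1 := by
      rw [show -((θ : ℂ) * Complex.I) = ((-θ : ℝ) : ℂ) * Complex.I by push_cast; ring,
        Complex.norm_exp_ofReal_mul_I]
    have h3 : ‖Complex.exp (-((n : ℂ) * θ * Complex.I))‖ = 1 := by
      rw [show -((n : ℂ) * θ * Complex.I) = ((-(n * θ) : ℝ) : ℂ) * Complex.I by push_cast; ring,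
        Complex.norm_exp_ofReal_mul_I]
    simp only [hF, norm_mul, norm_div, norm_pow, Complex.norm_natCast, Complex.norm_real,
      Complex.norm_exp_ofReal_mul_I, Complex.norm_two, mul_one, Real.norm_eq_abs, h2, h3]
  -- dominated convergence for the series
  have hsumF : HasSum (fun p => ∫ θ in (0 : ℝ)..2 * π, F p θ)
      (∫ θ in (0 : ℝ)..2 * π,
        Complex.exp ((x : ℂ) * Real.cos θ) * Complex.exp (-((n : ℂ) * θ * Complex.I))) := by
    have hbs : Summable fun p : ℕ × ℕ => (|x| / 2) ^ p.1 / (p.1 ! : ℝ) * ((|x| / 2) ^ p.2 / (p.2 ! : ℝ)) :=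
      (Real.summable_pow_div_factorial _).mul_of_nonneg (Real.summable_pow_div_factorial _)
        (fun _ => by positivity) (fun _ => by positivity)
    refine intervalIntegral.hasSum_integral_of_dominated_convergence
      (fun (p : ℕ × ℕ) (_ : ℝ) => (|x| / 2) ^ p.1 / (p.1 ! : ℝ) * ((|x| / 2) ^ p.2 / (p.2 ! : ℝ)))
      (fun p => (hFcont p).aestronglyMeasurable) (fun p => Eventually.of_forall fun θ _ => ?_)
      (Eventually.of_forall fun θ _ => hbs) (by exact intervalIntegrable_const)
      (Eventually.of_forall fun θ _ => ?_)
    · rw [hFnorm]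
    · simp only [hF]
      exact (hasSum_generatingFunctionI x θ).mul_right _
  -- each term integrates to `2π ·` (series term) on the diagonal `j = k + n`, and to `0` elsewhere
  have hterm : ∀ p : ℕ × ℕ, ∫ θ in (0 : ℝ)..2 * π, F p θ =
      (x / 2 : ℂ) ^ p.1 / (p.1 ! : ℂ) * ((x / 2 : ℂ) ^ p.2 / (p.2 ! : ℂ)) *
        (if ((p.1 : ℤ) - p.2 - n) = 0 then 2 * (π : ℂ) else 0) := by
    intro p
    rw [← integral_cexp_int_mul, ← intervalIntegral.integral_const_mul]
    refine intervalIntegral.integral_congr fun θ _ => ?_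
    simp only [hF]
    have : Complex.exp ((p.1 : ℂ) * (θ * Complex.I)) * Complex.exp ((p.2 : ℂ) * -(θ * Complex.I)) *
        Complex.exp (-((n : ℂ) * θ * Complex.I)) =
        Complex.exp ((((p.1 : ℤ) - p.2 - n : ℤ) : ℂ) * θ * Complex.I) := by
      rw [← Complex.exp_add, ← Complex.exp_add]
      congr 1
      push_cast
      ring
    rw [mul_pow, mul_pow, ← Complex.exp_nat_mul, ← Complex.exp_nat_mul, ← this]
    ring
  -- reindex the diagonal by `k ↦ (k + n, k)`
  set g : ℕ → ℕ × ℕ := fun k => (k + n, k) with hg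
  have hginj : Function.Injective g := fun a b h => by
    simp only [hg, Prod.mk.injEq] at h; exact h.2
  have hoff : ∀ p ∉ Set.range g, (∫ θ in (0 : ℝ)..2 * π, F p θ) = 0 := by
    intro p hp
    rw [hterm]
    have hne : ((p.1 : ℤ) - p.2 - n) ≠ 0 := by
      intro h
      apply hp
      refine ⟨p.2, ?_⟩
      simp only [hg]
      ext
      · simp only; omega
      · rfl
    rw [if_neg hne, mul_zero]
  have hdiag : ∀ k : ℕ, (∫ θ in (0 : ℝ)..2 * π, F (g k) θ) = (2 * π : ℂ) *
      ((((x / 2) ^ (2 * k + n) / ((k ! : ℝ) * ((k + n) ! : ℝ)) : ℝ) : ℂ)) := by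
    intro k
    rw [hterm]
    simp only [hg]
    have h0 : ((k + n : ℕ) : ℤ) - (k : ℕ) - (n : ℤ) = 0 := by push_cast; ring
    rw [if_pos h0]
    have key : (x / 2) ^ (k + n) / ((k + n) ! : ℝ) * ((x / 2) ^ k / (k ! : ℝ)) * (2 * π) =
        2 * π * ((x / 2) ^ (2 * k + n) / ((k ! : ℝ) * ((k + n) ! : ℝ))) := by
      rw [show 2 * k + n = (k + n) + k by ring, pow_add]
      ring
    exact_mod_cast key
  have h := (hginj.hasSum_iff hoff).mpr hsumF
  simpa only [Function.comp_def, hdiag] using h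

/-! ### 3. The power series of the tree's `besselI` and the full-period integral -/

/-- The symmetry `θ ↦ 2π − θ`: `∫₀^{2π} e^{x cos θ} cos(nθ) dθ = 2 ∫₀^{π} e^{x cos θ} cos(nθ) dθ`.
[folklore] -/
private theorem integral_exp_mul_cos_mul_cos_two_pi_eq_two_mul (n : ℕ) (x : ℝ) :
    ∫ θ in (0 : ℝ)..2 * π, Real.exp (x * Real.cos θ) * Real.cos (n * θ) =
      2 * ∫ θ in (0 : ℝ)..π, Real.exp (x * Real.cos θ) * Real.cos (n * θ) := by
  set f : ℝ → ℝ := fun θ => Real.exp (x * Real.cos θ) * Real.cos (n * θ) with hf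
  have hfc : Continuous f := by simp only [hf]; fun_prop
  have hsymm : ∀ θ : ℝ, f (2 * π - θ) = f θ := by
    intro θ
    simp only [hf]
    rw [Real.cos_two_pi_sub, show (n : ℝ) * (2 * π - θ) = -(n * θ) + n * (2 * π) by ring,
      Real.cos_add_nat_mul_two_pi, Real.cos_neg]
  rw [← intervalIntegral.integral_add_adjacent_intervals (hfc.intervalIntegrable 0 π)
    (hfc.intervalIntegrable π (2 * π))]
  have h := intervalIntegral.integral_comp_sub_left f (2 * π) (a := π) (b := 2 * π)
  simp only [hsymm, sub_self, show 2 * π - π = π by ring] at h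
  rw [h]
  ring

/-- **`∫₀^{2π} e^{x cos θ} cos(nθ) dθ = 2π I_n(x)`** for the tree's `besselI` (DLMF 10.32.3 over a
full period). [cite: DLMF, 10.32.3] -/
theorem integral_exp_mul_cos_mul_cos (n : ℕ) (x : ℝ) :
    ∫ θ in (0 : ℝ)..2 * π, Real.exp (x * Real.cos θ) * Real.cos (n * θ) = 2 * π * besselI n x := by
  rw [integral_exp_mul_cos_mul_cos_two_pi_eq_two_mul, besselI, ← mul_assoc,
    mul_inv_cancel_right₀ Real.pi_ne_zero]

/-- The complex integrand split into real and imaginary parts: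
`e^{x cos θ} e^{−inθ} = e^{x cos θ} cos(nθ) − i e^{x cos θ} sin(nθ)`. [folklore] -/
private theorem cexp_cos_mul_cexp_neg_eq (n : ℕ) (x θ : ℝ) :
    Complex.exp ((x : ℂ) * Real.cos θ) * Complex.exp (-((n : ℂ) * θ * Complex.I)) =
      ((Real.exp (x * Real.cos θ) * Real.cos (n * θ) : ℝ) : ℂ) +
        ((-(Real.exp (x * Real.cos θ) * Real.sin (n * θ)) : ℝ) : ℂ) * Complex.I := by
  rw [cexp_mul_cos_eq_ofReal, show -((n : ℂ) * θ * Complex.I) = ((-(n * θ) : ℝ) : ℂ) * Complex.I by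
    push_cast; ring, Complex.exp_mul_I]
  push_cast
  rw [Complex.cos_neg, Complex.sin_neg]
  ring

/-- The full-period integral in `HasSum` form (real part of
`hasSum_integral_cexp_cos_mul_cexp_neg`). [cite: Watson1944, §2.2] -/
theorem hasSum_integral_exp_mul_cos_mul_cos (n : ℕ) (x : ℝ) :
    HasSum (fun k : ℕ => 2 * π * ((x / 2) ^ (2 * k + n) / ((k ! : ℝ) * ((k + n) ! : ℝ))))
      (∫ θ in (0 : ℝ)..2 * π, Real.exp (x * Real.cos θ) * Real.cos (n * θ)) := by
  have h := hasSum_integral_cexp_cos_mul_cexp_neg n x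
  have hc : Continuous fun θ : ℝ => Real.exp (x * Real.cos θ) * Real.cos (n * θ) := by fun_prop
  have hs : Continuous fun θ : ℝ => -(Real.exp (x * Real.cos θ) * Real.sin (n * θ)) := by fun_prop
  have hi1 : IntervalIntegrable
      (fun θ : ℝ => (((Real.exp (x * Real.cos θ) * Real.cos (n * θ)) : ℝ) : ℂ)) volume 0 (2 * π) :=
    (Complex.continuous_ofReal.comp hc).intervalIntegrable _ _
  have hi2 : IntervalIntegrable
      (fun θ : ℝ => (((-(Real.exp (x * Real.cos θ) * Real.sin (n * θ))) : ℝ) : ℂ) * Complex.I)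
        volume 0 (2 * π) :=
    ((Complex.continuous_ofReal.comp hs).mul continuous_const).intervalIntegrable _ _
  simp_rw [cexp_cos_mul_cexp_neg_eq] at h
  rw [intervalIntegral.integral_add hi1 hi2, intervalIntegral.integral_mul_const,
    intervalIntegral.integral_ofReal, intervalIntegral.integral_ofReal] at h
  have h3 : HasSum (fun k : ℕ =>
      (((2 * π * ((x / 2) ^ (2 * k + n) / ((k ! : ℝ) * ((k + n) ! : ℝ)))) : ℝ) : ℂ))
      ((((∫ θ in (0 : ℝ)..2 * π, Real.exp (x * Real.cos θ) * Real.cos (n * θ)) : ℝ) : ℂ) +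
        (((∫ θ in (0 : ℝ)..2 * π, -(Real.exp (x * Real.cos θ) * Real.sin (n * θ))) : ℝ) : ℂ) *
          Complex.I) :=
    h.congr_fun fun k => by push_cast; ring
  have h4 := Complex.hasSum_re h3
  simp only [Complex.ofReal_re, Complex.add_re, Complex.mul_re, Complex.I_re, Complex.I_im,
    Complex.ofReal_im, mul_zero, zero_mul, sub_zero, add_zero] at h4
  exact h4

/-- **The power series of `I_n`**: `I_n(x) = Σ_{k ≥ 0} (x/2)^{2k+n}/(k!(k+n)!)` for the tree's
integral-defined `besselI` (`n ∈ ℕ`, `x ∈ ℝ`). [cite: DLMF, 10.25.2] -/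
theorem hasSum_besselI (n : ℕ) (x : ℝ) :
    HasSum (fun k : ℕ => (x / 2) ^ (2 * k + n) / ((k ! : ℝ) * ((k + n) ! : ℝ))) (besselI n x) := by
  have h := (hasSum_integral_exp_mul_cos_mul_cos n x).div_const (2 * π)
  rw [integral_exp_mul_cos_mul_cos] at h
  have h2π : (2 * π : ℝ) ≠ 0 := by positivity
  simpa only [mul_div_cancel_left₀ _ h2π] using h

/-- **The complex Fourier coefficients of `e^{x cos θ}`**:
`∫₀^{2π} e^{x cos θ} e^{−inθ} dθ = 2π I_n(x)` (`n ∈ ℕ`). [cite: DLMF, 10.32.3] -/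
theorem integral_cexp_cos_mul_cexp_neg_nat (n : ℕ) (x : ℝ) :
    ∫ θ in (0 : ℝ)..2 * π,
        Complex.exp ((x : ℂ) * Real.cos θ) * Complex.exp (-((n : ℂ) * θ * Complex.I)) =
      2 * π * (besselI n x : ℂ) := by
  have h1 := hasSum_integral_cexp_cos_mul_cexp_neg n x
  have h2 : HasSum (fun k : ℕ => (2 * π : ℂ) *
      ((((x / 2) ^ (2 * k + n) / ((k ! : ℝ) * ((k + n) ! : ℝ)) : ℝ) : ℂ))) (2 * π * (besselI n x : ℂ)) :=
    (Complex.ofRealCLM.hasSum (hasSum_besselI n x)).mul_left (2 * π : ℂ)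
  exact h1.unique h2

/-! ### 4. Sign and size from the series -/

/-- `I_n(x) ≥ 0` for `x ≥ 0` (all terms of the series are non-negative). [cite: DLMF, 10.25.2] -/
theorem besselI_nonneg (n : ℕ) {x : ℝ} (hx : 0 ≤ x) : 0 ≤ besselI n x :=
  (hasSum_besselI n x).nonneg fun k => by positivity

/-- **Parity in the argument**: `I_n(−x) = (−1)ⁿ I_n(x)` (integer order; DLMF 10.34.1 with
`m = 1`). [cite: DLMF, 10.34.1] -/
theorem besselI_neg_arg (n : ℕ) (x : ℝ) : besselI n (-x) = (-1) ^ n * besselI n x := by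
  refine (hasSum_besselI n (-x)).unique (((hasSum_besselI n x).mul_left ((-1) ^ n)).congr_fun
    fun k => ?_)
  have h : (-x / 2) ^ (2 * k + n) = (-1) ^ n * (x / 2) ^ (2 * k + n) := by
    rw [neg_div, neg_pow, pow_add, pow_mul, neg_one_sq, one_pow, one_mul]
  rw [h, mul_div_assoc]

/-- `|I_n(x)| = I_n(|x|)` for real `x`: the real-argument form of the parity relation DLMF 10.34.1
together with the positivity of the series 10.25.2. [cite: DLMF, 10.34.1] -/
theorem abs_besselI_eq_besselI_abs (n : ℕ) (x : ℝ) : |besselI n x| = besselI n |x| := by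
  rcases le_or_gt 0 x with hx | hx
  · rw [abs_of_nonneg hx, abs_of_nonneg (besselI_nonneg n hx)]
  · obtain ⟨y, rfl⟩ : ∃ y, x = -y := ⟨-x, (neg_neg x).symm⟩
    have hy : 0 ≤ y := by linarith
    rw [besselI_neg_arg, abs_neg, abs_of_nonneg hy, abs_mul, abs_pow, abs_neg, abs_one, one_pow,
      one_mul, abs_of_nonneg (besselI_nonneg n hy)]

/-! ### 5. The generating function: `e^{x cos θ} = Σ_{m ∈ ℤ} I_{|m|}(x) e^{imθ}` -/

/-- Book-keeping for the fibres `j − k = m` of the double series: with `j = k + m⁺`, `l = k + m⁻`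
one has `j + l = 2k + |m|`, `j − l = m` and `j! l! = k! (k + |m|)!`. [folklore] -/
private theorem factorial_add_toNat_mul (m : ℤ) (k : ℕ) :
    (k + m.toNat) ! * (k + (-m).toNat) ! = k ! * (k + m.natAbs) ! := by
  obtain ⟨a, ha⟩ : ∃ a : ℕ, m.natAbs = a := ⟨_, rfl⟩
  rw [ha]
  rcases Int.natAbs_eq m with h | h <;> rw [ha] at h <;> rw [h]
  · rw [Int.toNat_natCast, Int.toNat_neg_natCast, add_zero, mul_comm]
  · rw [neg_neg, Int.toNat_natCast, Int.toNat_neg_natCast, add_zero]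

/-- The summand identity on the fibre `j − l = m`:
`((x/2)e^{iθ})^j/j! · ((x/2)e^{−iθ})^l/l! = (x/2)^{2k+|m|}/(k!(k+|m|)!) · e^{imθ}` for
`j = k + m⁺`, `l = k + m⁻`. [folklore] -/
private theorem generatingTermI_fibre (x θ : ℝ) (m : ℤ) (k : ℕ) :
    ((x / 2 : ℂ) * Complex.exp (θ * Complex.I)) ^ (k + m.toNat) / ((k + m.toNat) ! : ℂ) *
        (((x / 2 : ℂ) * Complex.exp (-(θ * Complex.I))) ^ (k + (-m).toNat) /
          ((k + (-m).toNat) ! : ℂ)) =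
      (((x / 2) ^ (2 * k + m.natAbs) / ((k ! : ℝ) * ((k + m.natAbs) ! : ℝ)) : ℝ) : ℂ) *
        Complex.exp ((m : ℂ) * θ * Complex.I) := by
  have hsum : k + m.toNat + (k + (-m).toNat) = 2 * k + m.natAbs := by omega
  have hdiff : ((k + m.toNat : ℕ) : ℤ) - ((k + (-m).toNat : ℕ) : ℤ) = m := by omega
  have hfact : ((k + m.toNat) ! : ℂ) * ((k + (-m).toNat) ! : ℂ) =
      (k ! : ℂ) * ((k + m.natAbs) ! : ℂ) := by exact_mod_cast factorial_add_toNat_mul m k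
  have hexp : Complex.exp (((k + m.toNat : ℕ) : ℂ) * (θ * Complex.I)) *
      Complex.exp (((k + (-m).toNat : ℕ) : ℂ) * -(θ * Complex.I)) =
        Complex.exp ((m : ℂ) * θ * Complex.I) := by
    rw [← Complex.exp_add]
    congr 1
    have hm : (m : ℂ) = ((k + m.toNat : ℕ) : ℂ) - ((k + (-m).toNat : ℕ) : ℂ) := by
      exact_mod_cast hdiff.symm
    rw [hm]
    ring
  have hne : ((k + m.toNat) ! : ℂ) * ((k + (-m).toNat) ! : ℂ) ≠ 0 :=
    mul_ne_zero (Nat.cast_ne_zero.mpr (Nat.factorial_ne_zero _))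
      (Nat.cast_ne_zero.mpr (Nat.factorial_ne_zero _))
  rw [mul_pow, mul_pow, ← Complex.exp_nat_mul, ← Complex.exp_nat_mul]
  calc (x / 2 : ℂ) ^ (k + m.toNat) * Complex.exp (((k + m.toNat : ℕ) : ℂ) * (θ * Complex.I)) /
          ((k + m.toNat) ! : ℂ) *
        ((x / 2 : ℂ) ^ (k + (-m).toNat) * Complex.exp (((k + (-m).toNat : ℕ) : ℂ) * -(θ * Complex.I)) /
          ((k + (-m).toNat) ! : ℂ))
      = (x / 2 : ℂ) ^ (k + m.toNat + (k + (-m).toNat)) /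
          (((k + m.toNat) ! : ℂ) * ((k + (-m).toNat) ! : ℂ)) *
          (Complex.exp (((k + m.toNat : ℕ) : ℂ) * (θ * Complex.I)) *
            Complex.exp (((k + (-m).toNat : ℕ) : ℂ) * -(θ * Complex.I))) := by
        rw [pow_add (x / 2 : ℂ) (k + m.toNat) (k + (-m).toNat)]
        field_simp
    _ = (x / 2 : ℂ) ^ (2 * k + m.natAbs) / ((k ! : ℂ) * ((k + m.natAbs) ! : ℂ)) *
          Complex.exp ((m : ℂ) * θ * Complex.I) := by rw [hsum, hfact, hexp]
    _ = _ := by push_cast; ring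

/-- **The generating function of the modified Bessel functions** (Fourier series of `e^{x cos θ}`):
`e^{x cos θ} = Σ_{m ∈ ℤ} I_{|m|}(x) e^{imθ}` for all real `x, θ` — DLMF 10.35.1
`e^{(z/2)(t + 1/t)} = Σ_{m ∈ ℤ} t^m I_m(z)` at `t = e^{iθ}`, with `I_{−m} = I_m`; summing the
absolutely convergent double series `hasSum_generatingFunctionI` over the fibres `j − l = m`.
[cite: DLMF, 10.35.1] -/
theorem hasSum_besselI_natAbs_mul_cexp (x θ : ℝ) :
    HasSum (fun m : ℤ => (besselI m.natAbs x : ℂ) * Complex.exp ((m : ℂ) * θ * Complex.I))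
      (Complex.exp ((x : ℂ) * Real.cos θ)) := by
  -- the reindexing bijection `(m, k) ↦ (k + m⁺, k + m⁻)`, whose fibres over `m` are the diagonals
  let e : ℤ × ℕ ≃ ℕ × ℕ :=
    { toFun := fun q => (q.2 + q.1.toNat, q.2 + (-q.1).toNat)
      invFun := fun p => ((p.1 : ℤ) - p.2, min p.1 p.2)
      left_inv := fun q => by ext <;> simp only <;> omega
      right_inv := fun p => by ext <;> simp only <;> omega }
  have hf := (e.hasSum_iff).mpr (hasSum_generatingFunctionI x θ)
  refine hf.prod_fiberwise fun m => ?_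
  have hs := (Complex.ofRealCLM.hasSum (hasSum_besselI m.natAbs x)).mul_right
    (Complex.exp ((m : ℂ) * θ * Complex.I))
  refine hs.congr_fun fun k => ?_
  simp only [Function.comp_apply, e, Equiv.coe_fn_mk, Complex.ofRealCLM_apply]
  exact generatingTermI_fibre x θ m k

/-- The real Fourier series: `e^{x cos θ} = Σ_{m ∈ ℤ} I_{|m|}(x) cos(mθ)`
(`= I₀(x) + 2 Σ_{k ≥ 1} I_k(x) cos(kθ)`). [cite: DLMF, 10.35.2] -/
theorem hasSum_besselI_natAbs_mul_cos (x θ : ℝ) :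
    HasSum (fun m : ℤ => besselI m.natAbs x * Real.cos (m * θ)) (Real.exp (x * Real.cos θ)) := by
  have h := Complex.hasSum_re (hasSum_besselI_natAbs_mul_cexp x θ)
  rw [cexp_mul_cos_eq_ofReal, Complex.ofReal_re] at h
  refine h.congr_fun fun m => ?_
  rw [show (m : ℂ) * θ * Complex.I = ((m * θ : ℝ) : ℂ) * Complex.I by push_cast; ring,
    Complex.exp_mul_I, ← Complex.ofReal_cos, ← Complex.ofReal_sin]
  simp only [Complex.mul_re, Complex.add_re, Complex.add_im, Complex.mul_im, Complex.ofReal_re,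
    Complex.ofReal_im, Complex.I_re, Complex.I_im]
  ring

/-- At `θ = 0`: `Σ_{m ∈ ℤ} I_{|m|}(x) = eˣ`. [cite: DLMF, 10.35.5] -/
theorem hasSum_besselI_natAbs (x : ℝ) : HasSum (fun m : ℤ => besselI m.natAbs x) (Real.exp x) := by
  simpa using hasSum_besselI_natAbs_mul_cos x 0

/-- `m ↦ I_{|m|}(x)` is summable over `ℤ`. [cite: DLMF, 10.35.5] -/
theorem summable_besselI_natAbs (x : ℝ) : Summable fun m : ℤ => besselI m.natAbs x :=
  (hasSum_besselI_natAbs x).summable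

/-- **Absolute convergence of the generating function** (the Laurent series DLMF 10.35.1 on
`|t| = 1`): for every real phase `α`, `Σ_{m ∈ ℤ} ‖I_{|m|}(x) e^{imα}‖ = Σ_m I_{|m|}(|x|) = e^{|x|} < ∞`.
[cite: DLMF, 10.35.1] -/
theorem summable_norm_besselI_natAbs_mul_cexp (x α : ℝ) :
    Summable fun m : ℤ => ‖(besselI m.natAbs x : ℂ) * Complex.exp ((m : ℂ) * α * Complex.I)‖ := by
  refine (summable_besselI_natAbs |x|).of_nonneg_of_le (fun _ => norm_nonneg _) fun m => ?_
  rw [norm_mul, show (m : ℂ) * α * Complex.I = ((m * α : ℝ) : ℂ) * Complex.I by push_cast; ring,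
    Complex.norm_exp_ofReal_mul_I, mul_one, Complex.norm_real, Real.norm_eq_abs]
  exact (abs_besselI_eq_besselI_abs _ _).le

end Literature.Analysis.FunctionSpaces
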